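import Mathlib
import HarnessLib
import Summits.QuantumFields.YangMills.Theses.LangevinControlUV

/-!
# Sketch — crux-ideate stmt-QuantumFields-9365 (FemtoCurvatureSkewness), ideator 3, round 1

First-lemma signatures for the idea cards `permanental-rigidity` and `background-shifted-positivity`.
Nothing here is a route item; `sorry` only in the two transfer theorems at the end.
-/

namespace Summit.QuantumFields.YangMills.Cruxes.FemtoCurvatureSkewness.Sketch

open MeasureTheory ProbabilityTheory
open scoped BigOperators

noncomputable section

/-- joint third cumulant of three real observables under `μ` (Bochner integrals). -/
def cum3 {Ω : Type*} [MeasurableSpace Ω] (μ : Measure Ω) (X Y Z : Ω → ℝ) : ℝ :=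
  ∫ ω, (X ω - ∫ ω', X ω' ∂μ) * (Y ω - ∫ ω', Y ω' ∂μ) * (Z ω - ∫ ω', Z ω' ∂μ) ∂μ

/-- covariance of two real observables under `μ`. -/
def cov2 {Ω : Type*} [MeasurableSpace Ω] (μ : Measure Ω) (X Y : Ω → ℝ) : ℝ :=
  ∫ ω, (X ω - ∫ ω', X ω' ∂μ) * (Y ω - ∫ ω', Y ω' ∂μ) ∂μ

/-- **PermanentalRigidity (card `permanental-rigidity`, first lemma; provable now).** For a centred
Gaussian triple `φ_a = ∑ M a i ξ_i` (`ξ` iid standard normal) with Gram matrix `g = M Mᵀ`, the squares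
satisfy `Cov(φ₀², φ₁²) = 2 g₀₁²` and `κ₃(φ₀², φ₁², φ₂²) = 8 g₀₁ g₁₂ g₂₀` (Isserlis/Wick); hence
`|κ₃| = 2^{3/2} (Cov₀₁ Cov₁₂ Cov₂₀)^{1/2}`: the modulus of the odd cumulant of a permanental
(squared-Gaussian) triple is a function of its covariances. `d` iid colour copies multiply both sides
by `d` (cumulants add over independent summands), giving the factor `d^{-1/2}`. -/
def PermanentalRigidity : Prop :=
  ∀ (m : ℕ) (M : Matrix (Fin 3) (Fin m) ℝ),
    let μ : Measure (Fin m → ℝ) := Measure.pi fun _ => gaussianReal 0 1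
    let φ : Fin 3 → (Fin m → ℝ) → ℝ := fun a ξ => ∑ i, M a i * ξ i
    let g : Matrix (Fin 3) (Fin 3) ℝ := M * M.transpose
    cov2 μ (fun ξ => φ 0 ξ ^ 2) (fun ξ => φ 1 ξ ^ 2) = 2 * g 0 1 ^ 2 ∧
    cum3 μ (fun ξ => φ 0 ξ ^ 2) (fun ξ => φ 1 ξ ^ 2) (fun ξ => φ 2 ξ ^ 2) = 8 * g 0 1 * g 1 2 * g 2 0

/-- the scalar core of the rigidity transfer: relative error `θ` on a non-negative prediction `p`
leaves the lower bound `(1-θ) p`. -/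
theorem lower_of_relative_error (k p θ : ℝ) (h : |k - p| ≤ θ * p) : (1 - θ) * p ≤ k := by
  have := (abs_sub_le_iff.mp h).2
  nlinarith

/-- **TotalCumulance (card `background-shifted-positivity`, first lemma; provable now — Brillinger
1969).** Law of total cumulance for a sub-σ-algebra `m`: writing `Xc = μ[X|m]` etc.,
`κ₃(X,Y,Z) = E[(X-Xc)(Y-Yc)(Z-Zc)] + E[(Xc-EX)(Y-Yc)(Z-Zc)] + E[(Yc-EY)(X-Xc)(Z-Zc)]
 + E[(Zc-EZ)(X-Xc)(Y-Yc)] + E[(Xc-EX)(Yc-EY)(Zc-EZ)]` (the three terms with exactly one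
un-conditioned factor vanish). Conditioning on the constant (toron) modes / on slow modes, each
surviving term is signed in the Gaussian-with-background picture (NOTES F3). -/
def TotalCumulance : Prop :=
  ∀ (Ω : Type) (m mΩ : MeasurableSpace Ω) (μ : @Measure Ω mΩ), @IsProbabilityMeasure Ω mΩ μ → m ≤ mΩ →
    ∀ (X Y Z : Ω → ℝ), @Measurable Ω ℝ mΩ _ X → @Measurable Ω ℝ mΩ _ Y → @Measurable Ω ℝ mΩ _ Z →
    (∀ ω, |X ω| ≤ 1) → (∀ ω, |Y ω| ≤ 1) → (∀ ω, |Z ω| ≤ 1) →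
    let Xc : Ω → ℝ := condExp m μ X
    let Yc : Ω → ℝ := condExp m μ Y
    let Zc : Ω → ℝ := condExp m μ Z
    let EX := ∫ ω, X ω ∂μ; let EY := ∫ ω, Y ω ∂μ; let EZ := ∫ ω, Z ω ∂μ
    @cum3 Ω mΩ μ X Y Z =
      (∫ ω, (X ω - Xc ω) * (Y ω - Yc ω) * (Z ω - Zc ω) ∂μ)
      + (∫ ω, (Xc ω - EX) * (Y ω - Yc ω) * (Z ω - Zc ω) ∂μ)
      + (∫ ω, (Yc ω - EY) * (X ω - Xc ω) * (Z ω - Zc ω) ∂μ)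
      + (∫ ω, (Zc ω - EZ) * (X ω - Xc ω) * (Y ω - Yc ω) ∂μ)
      + (∫ ω, (Xc ω - EX) * (Yc ω - EY) * (Zc ω - EZ) ∂μ)

/-- **PerpPropagatorPos (card `background-shifted-positivity`, stub; checked numerically by kit job
j009212).** The zero-mode-free lattice propagator of the `(0,1)`-plaquette field on the `L⁴` torus,
`C_L(x) = L⁻⁴ ∑_{k ≠ 0} (k̂₀²+k̂₁²)/k̂² cos(k·x)`, is positive at the crux's displacements `n e₂` and
`n(e₃ - e₂)` for `1 ≤ n ≤ L/8` (continuum: `(x_⊥² - x_∥²)/(π² x⁶) > 0` for perpendicular `x`). -/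
def PerpPropagatorPos : Prop :=
  ∀ (L n : ℕ) [NeZero L], 1 ≤ n → 8 * n ≤ L →
    let kh : (Fin 4 → ZMod L) → Fin 4 → ℝ := fun k i => 2 - 2 * Real.cos (2 * Real.pi * ((k i).val : ℝ) / L)
    let w : (Fin 4 → ZMod L) → ℝ := fun k => if k = 0 then 0 else (kh k 0 + kh k 1) / (kh k 0 + kh k 1 + kh k 2 + kh k 3)
    0 < ∑ k : Fin 4 → ZMod L, w k * Real.cos (2 * Real.pi * ((k 2).val : ℝ) * n / L) ∧
    0 < ∑ k : Fin 4 → ZMod L, w k * Real.cos (2 * Real.pi * (((k 3).val : ℝ) - ((k 2).val : ℝ)) * n / L)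

/-- **ToronSkewnessPos (card `background-shifted-positivity`, stub).** On the one-site torus
(`L = 1`: four links, commutator plaquettes — the constant-mode/toron sector at tree level) the
plaquette energy `P₀₁` has positive third central moment at large coupling. -/
def ToronSkewnessPos : Prop :=
  open Literature.MathematicalPhysics.QuantumFieldTheory in ∀ (G : Type) [Group G] [TopologicalSpace G] [IsTopologicalGroup G] [CompactSpace G], IsCompactSimpleLieGroup G → letI : MeasurableSpace G := borel G; haveI : BorelSpace G := ⟨rfl⟩; ∀ (r : LatticeRep G), ∃ B₀ : ℝ, ∀ B : ℝ, B₀ ≤ B → let P : GaugeConfig 4 1 G → ℝ := fun U => (r.N : ℝ) - (r.ρ (plaquetteHolonomy U 0 0 1)).trace.re; let E : (GaugeConfig 4 1 G → ℝ) → ℝ := fun F => wilsonExpectation (d := 4) (L := 1) r.ρ B F; 0 < E (fun U => (P U - E P) ^ 3)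

/-- **OUCovarianceIdentity (card `malliavin-cumulant-formula`, first lemma; provable now).** The
finite-dimensional Ornstein–Uhlenbeck / Mehler form of the Malliavin integration by parts
`Cov(F,G) = E⟨DF, −DL⁻¹G⟩`: for polynomial `F, G` of `m` iid standard Gaussians,
`Cov(F,G) = ∫₀^∞ e^{-t} E_x[ Σ_i ∂_iF(x) · E_y[∂_iG(e^{-t}x + √(1-e^{-2t}) y)] ] dt`.
Applied twice it gives the Nourdin–Peccati formula for `κ₃` whose second-chaos part is the permanental
triangle and whose higher-chaos corrections carry the damping `−L⁻¹ = 1/k` on the `k`-th chaos. -/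
def OUCovarianceIdentity : Prop :=
  ∀ (m : ℕ) (p q : MvPolynomial (Fin m) ℝ),
    let μ : Measure (Fin m → ℝ) := Measure.pi fun _ => gaussianReal 0 1
    let F : (Fin m → ℝ) → ℝ := fun x => MvPolynomial.eval x p
    let G : (Fin m → ℝ) → ℝ := fun x => MvPolynomial.eval x q
    let pd : ((Fin m → ℝ) → ℝ) → Fin m → (Fin m → ℝ) → ℝ :=
      fun H i x => deriv (fun s => H (Function.update x i s)) (x i)
    cov2 μ F G = ∫ t in Set.Ioi (0 : ℝ), Real.exp (-t) *
      ∫ x, ∑ i, pd F i x * (∫ y, pd G i (fun j => Real.exp (-t) * x j + Real.sqrt (1 - Real.exp (-2 * t)) * y j) ∂μ) ∂μ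

/-- **RigidityCore (C⁰ — what both cards prove; UV/femto only).** The engine's unit map `a`
carries the 9363 two-point package AND, in its femto regime, the rigidity lower bound
`n¹²|κ₃| ≥ c₃ (n⁸ Cov(P₀,P_{ne₂}))^{3/2}` — skewness dominated below by covariance^{3/2}; the running
coupling enters only through the covariance, so no β-function coefficient appears. -/
def RigidityCore : Prop :=
  open Literature.MathematicalPhysics.QuantumFieldTheory in ∀ (G : Type) [Group G] [TopologicalSpace G] [IsTopologicalGroup G] [CompactSpace G], IsCompactSimpleLieGroup G → letI : MeasurableSpace G := borel G; haveI : BorelSpace G := ⟨rfl⟩; ∀ (r : LatticeRep G), ∃ (a : ℝ → ℝ), (∃ (Γ : ℝ → ℝ) (β₀ ℓ₀ c C : ℝ), 0 < ℓ₀ ∧ 0 < c ∧ (∀ β, 0 < a β) ∧ Filter.Tendsto a Filter.atTop (nhds 0) ∧ (∀ s : ℝ, 0 < s → s ≤ ℓ₀ → 0 < Γ s ∧ Γ s ≤ 1) ∧ ∀ (L : ℕ) [NeZero L] (β : ℝ), β₀ ≤ β → (L : ℝ) * a β ≤ ℓ₀ → let P : (Fin 4 → ZMod L) → Fin 4 →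 Fin 4 → GaugeConfig 4 L G → ℝ := fun x i j U => (r.N : ℝ) - (r.ρ (plaquetteHolonomy U x i j)).trace.re; let E : (GaugeConfig 4 L G → ℝ) → ℝ := fun F => wilsonExpectation (d := 4) (L := L) r.ρ β F; let cov : (GaugeConfig 4 L G → ℝ) → (GaugeConfig 4 L G → ℝ) → ℝ := fun F F' => E (fun U => F U * F' U) - E F * E F'; let dist : (Fin 4 → ZMod L) → (Fin 4 → ZMod L) → ℝ := fun x y => Real.sqrt (∑ k : Fin 4, (((x k - y k).valMinAbs : ℤ) : ℝ) ^ 2); (∀ n : ℕ, 1 ≤ n → 8 * n ≤ L → c * Γ ((n : ℝ) * a β) ≤ (n : ℝ) ^ 8 * cov (P 0 0 1) (P (Pi.single (2 : Fin 4) ((n : ℕ) : ZMod L)) 0 1) ∧ (n : ℝ) ^ 8 * cov (P 0 0 1) (P (Pi.single (2 : Fin 4) ((n : ℕ) : ZMod L)) 0 1) ≤ C * Γ ((n : ℝ) * a β)) ∧ (∀ (x y : Fin 4 → ZMod L) (i j i' j' : Fin 4), x ≠ y → i ≠ j → i' ≠ j' → |cov (P x i j) (P y i' j')| * dist x y ^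 8 ≤ C * Γ (dist x y * a β))) ∧ (∃ (β₁ ℓ₁ c₃ : ℝ), 0 < ℓ₁ ∧ 0 < c₃ ∧ ∀ (L : ℕ) [NeZero L] (β : ℝ), β₁ ≤ β → (L : ℝ) * a β ≤ ℓ₁ → let P : (Fin 4 → ZMod L) → Fin 4 → Fin 4 → GaugeConfig 4 L G → ℝ := fun x i j U => (r.N : ℝ) - (r.ρ (plaquetteHolonomy U x i j)).trace.re; let E : (GaugeConfig 4 L G → ℝ) → ℝ := fun F => wilsonExpectation (d := 4) (L := L) r.ρ β F; let cov : (GaugeConfig 4 L G → ℝ) → (GaugeConfig 4 L G → ℝ) → ℝ := fun F F' => E (fun U => F U * F' U) - E F * E F'; ∀ n : ℕ, 1 ≤ n → 8 * n ≤ L → c₃ * ((n : ℝ) ^ 8 * cov (P 0 0 1) (P (Pi.single (2 : Fin 4) ((n : ℕ) : ZMod L)) 0 1)) * Real.sqrt ((n : ℝ) ^ 8 * cov (P 0 0 1) (P (Pi.single (2 : Fin 4) ((n : ℕ) : ZMod L)) 0 1)) ≤ (n : ℝ) ^ 12 * |E (fun U => P 0 0 1 U * P (Pi.single (2 : Fin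 4) ((n : ℕ) : ZMod L)) 0 1 U * P (Pi.single (3 : Fin 4) ((n : ℕ) : ZMod L)) 0 1 U) - E (P 0 0 1) * cov (P (Pi.single (2 : Fin 4) ((n : ℕ) : ZMod L)) 0 1) (P (Pi.single (3 : Fin 4) ((n : ℕ) : ZMod L)) 0 1) - E (P (Pi.single (2 : Fin 4) ((n : ℕ) : ZMod L)) 0 1) * cov (P 0 0 1) (P (Pi.single (3 : Fin 4) ((n : ℕ) : ZMod L)) 0 1) - E (P (Pi.single (3 : Fin 4) ((n : ℕ) : ZMod L)) 0 1) * cov (P 0 0 1) (P (Pi.single (2 : Fin 4) ((n : ℕ) : ZMod L)) 0 1) - E (P 0 0 1) * E (P (Pi.single (2 : Fin 4) ((n : ℕ) : ZMod L)) 0 1) * E (P (Pi.single (3 : Fin 4) ((n : ℕ) : ZMod L)) 0 1)|)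

/-- **PermanentalDominance (C⁺ of card `permanental-rigidity`).** In the femto regime of the
engine's map, `n¹²|κ₃|` is within relative error `θ < 1` of the permanental prediction
`√8/√d·(∏ n⁸Cov)^{1/2}` (`d = dim G`), and the two other sides' covariances dominate a multiple of the
axis one (hypercubic symmetry / same proof). -/
def PermanentalDominance : Prop :=
  open Literature.MathematicalPhysics.QuantumFieldTheory in ∀ (G : Type) [Group G] [TopologicalSpace G] [IsTopologicalGroup G] [CompactSpace G], IsCompactSimpleLieGroup G → letI : MeasurableSpace G := borel G; haveI : BorelSpace G := ⟨rfl⟩; ∀ (r : LatticeRep G), ∃ (a : ℝ → ℝ), (∃ (Γ : ℝ → ℝ) (β₀ ℓ₀ c C : ℝ), 0 < ℓ₀ ∧ 0 < c ∧ (∀ β, 0 < a β) ∧ Filter.Tendsto a Filter.atTop (nhds 0) ∧ (∀ s : ℝ, 0 < s → s ≤ ℓ₀ → 0 < Γ s ∧ Γ s ≤ 1) ∧ ∀ (L : ℕ) [NeZero L] (β : ℝ), β₀ ≤ β → (L : ℝ) * a β ≤ ℓ₀ → let P : (Fin 4 → ZMod L) → Fin 4 → Fin 4 → GaugeConfig 4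 L G → ℝ := fun x i j U => (r.N : ℝ) - (r.ρ (plaquetteHolonomy U x i j)).trace.re; let E : (GaugeConfig 4 L G → ℝ) → ℝ := fun F => wilsonExpectation (d := 4) (L := L) r.ρ β F; let cov : (GaugeConfig 4 L G → ℝ) → (GaugeConfig 4 L G → ℝ) → ℝ := fun F F' => E (fun U => F U * F' U) - E F * E F'; let dist : (Fin 4 → ZMod L) → (Fin 4 → ZMod L) → ℝ := fun x y => Real.sqrt (∑ k : Fin 4, (((x k - y k).valMinAbs : ℤ) : ℝ) ^ 2); (∀ n : ℕ, 1 ≤ n → 8 * n ≤ L → c * Γ ((n : ℝ) * a β) ≤ (n : ℝ) ^ 8 * cov (P 0 0 1) (P (Pi.single (2 : Fin 4) ((n : ℕ) : ZMod L)) 0 1) ∧ (n : ℝ) ^ 8 * cov (P 0 0 1) (P (Pi.single (2 : Fin 4) ((n : ℕ) : ZMod L)) 0 1) ≤ C * Γ ((n : ℝ) * a β)) ∧ (∀ (x y : Fin 4 → ZMod L) (i j i' j' : Fin 4), x ≠ y → i ≠ j → i' ≠ j' → |cov (P x i j) (P y i' j')| * dist x y ^ 8 ≤ C * Γ (dist x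 y * a β))) ∧ (∃ (β₁ ℓ₁ d θ c' : ℝ), 0 < ℓ₁ ∧ 0 < d ∧ 0 ≤ θ ∧ θ < 1 ∧ 0 < c' ∧ ∀ (L : ℕ) [NeZero L] (β : ℝ), β₁ ≤ β → (L : ℝ) * a β ≤ ℓ₁ → let P : (Fin 4 → ZMod L) → Fin 4 → Fin 4 → GaugeConfig 4 L G → ℝ := fun x i j U => (r.N : ℝ) - (r.ρ (plaquetteHolonomy U x i j)).trace.re; let E : (GaugeConfig 4 L G → ℝ) → ℝ := fun F => wilsonExpectation (d := 4) (L := L) r.ρ β F; let cov : (GaugeConfig 4 L G → ℝ) → (GaugeConfig 4 L G → ℝ) → ℝ := fun F F' => E (fun U => F U * F' U) - E F * E F'; ∀ n : ℕ, 1 ≤ n → 8 * n ≤ L → |(n : ℝ) ^ 12 * |E (fun U => P 0 0 1 U * P (Pi.single (2 : Fin 4) ((n : ℕ) : ZMod L)) 0 1 U * P (Pi.single (3 : Fin 4) ((n : ℕ) : ZMod L)) 0 1 U) - E (P 0 0 1) * cov (P (Pi.single (2 : Fin 4) ((n : ℕ) : ZMod L)) 0 1) (P (Pi.single (3 : Fin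 4) ((n : ℕ) : ZMod L)) 0 1) - E (P (Pi.single (2 : Fin 4) ((n : ℕ) : ZMod L)) 0 1) * cov (P 0 0 1) (P (Pi.single (3 : Fin 4) ((n : ℕ) : ZMod L)) 0 1) - E (P (Pi.single (3 : Fin 4) ((n : ℕ) : ZMod L)) 0 1) * cov (P 0 0 1) (P (Pi.single (2 : Fin 4) ((n : ℕ) : ZMod L)) 0 1) - E (P 0 0 1) * E (P (Pi.single (2 : Fin 4) ((n : ℕ) : ZMod L)) 0 1) * E (P (Pi.single (3 : Fin 4) ((n : ℕ) : ZMod L)) 0 1)| - (Real.sqrt 8 / Real.sqrt d * Real.sqrt (((n : ℝ) ^ 8 * cov (P 0 0 1) (P (Pi.single (2 : Fin 4) ((n : ℕ) : ZMod L)) 0 1)) * ((n : ℝ) ^ 8 * cov (P 0 0 1) (P (Pi.single (3 : Fin 4) ((n : ℕ) : ZMod L)) 0 1)) * ((n : ℝ) ^ 8 * cov (P (Pi.single (2 : Fin 4) ((n : ℕ) : ZMod L)) 0 1) (P (Pi.single (3 : Fin 4) ((n : ℕ) : ZMod L)) 0 1))))| ≤ θ * (Real.sqrt 8 / Real.sqrt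 d * Real.sqrt (((n : ℝ) ^ 8 * cov (P 0 0 1) (P (Pi.single (2 : Fin 4) ((n : ℕ) : ZMod L)) 0 1)) * ((n : ℝ) ^ 8 * cov (P 0 0 1) (P (Pi.single (3 : Fin 4) ((n : ℕ) : ZMod L)) 0 1)) * ((n : ℝ) ^ 8 * cov (P (Pi.single (2 : Fin 4) ((n : ℕ) : ZMod L)) 0 1) (P (Pi.single (3 : Fin 4) ((n : ℕ) : ZMod L)) 0 1)))) ∧ c' * ((n : ℝ) ^ 8 * cov (P 0 0 1) (P (Pi.single (2 : Fin 4) ((n : ℕ) : ZMod L)) 0 1)) ≤ (n : ℝ) ^ 8 * cov (P 0 0 1) (P (Pi.single (3 : Fin 4) ((n : ℕ) : ZMod L)) 0 1) ∧ c' * ((n : ℝ) ^ 8 * cov (P 0 0 1) (P (Pi.single (2 : Fin 4) ((n : ℕ) : ZMod L)) 0 1)) ≤ (n : ℝ) ^ 8 * cov (P (Pi.single (2 : Fin 4) ((n : ℕ) : ZMod L)) 0 1) (P (Pi.single (3 : Fin 4) ((n : ℕ) : ZMod L)) 0 1))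

/-- **SkewnessForPackageMap — the assembly-sufficient form.** What `closes` actually consumes:
SOME unit map carries the two-point package together with the skewness witness (closes feeds
`hSkew` the very map obtained from `hUV`). Implied by `FemtoCurvatureTwoPoint ∧ FemtoCurvatureSkewness`
(`forPackageMap_of_crux`) and by `RigidityCore` (`forPackageMap_of_core`, Γ₃ := (cΓ)^{3/2}). -/
def SkewnessForPackageMap : Prop :=
  open Literature.MathematicalPhysics.QuantumFieldTheory in ∀ (G : Type) [Group G] [TopologicalSpace G] [IsTopologicalGroup G] [CompactSpace G], IsCompactSimpleLieGroup G → letI : MeasurableSpace G := borel G; haveI : BorelSpace G := ⟨rfl⟩; ∀ (r : LatticeRep G), (∃ (a : ℝ → ℝ), (∃ (Γ : ℝ → ℝ) (β₀ ℓ₀ c C : ℝ), 0 < ℓ₀ ∧ 0 < c ∧ (∀ β, 0 < a β) ∧ Filter.Tendsto a Filter.atTop (nhds 0) ∧ (∀ s : ℝ, 0 < s → s ≤ ℓ₀ → 0 < Γ s ∧ Γ s ≤ 1) ∧ ∀ (L : ℕ) [NeZero L] (β : ℝ), β₀ ≤ β → (L : ℝ) * a β ≤ ℓ₀ → let P : (Fin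 4 → ZMod L) → Fin 4 → Fin 4 → GaugeConfig 4 L G → ℝ := fun x i j U => (r.N : ℝ) - (r.ρ (plaquetteHolonomy U x i j)).trace.re; let E : (GaugeConfig 4 L G → ℝ) → ℝ := fun F => wilsonExpectation (d := 4) (L := L) r.ρ β F; let cov : (GaugeConfig 4 L G → ℝ) → (GaugeConfig 4 L G → ℝ) → ℝ := fun F F' => E (fun U => F U * F' U) - E F * E F'; let dist : (Fin 4 → ZMod L) → (Fin 4 → ZMod L) → ℝ := fun x y => Real.sqrt (∑ k : Fin 4, (((x k - y k).valMinAbs : ℤ) : ℝ) ^ 2); (∀ n : ℕ, 1 ≤ n → 8 * n ≤ L → c * Γ ((n : ℝ) * a β) ≤ (n : ℝ) ^ 8 * cov (P 0 0 1) (P (Pi.single (2 : Fin 4) ((n : ℕ) : ZMod L)) 0 1) ∧ (n : ℝ) ^ 8 * cov (P 0 0 1) (P (Pi.single (2 : Fin 4) ((n : ℕ) : ZMod L)) 0 1) ≤ C * Γ ((n : ℝ) * a β)) ∧ (∀ (x y : Fin 4 → ZMod L) (i j i' j' : Fin 4), x ≠ y → i ≠ j → i' ≠ j' → |cov (P x i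 j) (P y i' j')| * dist x y ^ 8 ≤ C * Γ (dist x y * a β)))) → ∃ (a : ℝ → ℝ), (∃ (Γ : ℝ → ℝ) (β₀ ℓ₀ c C : ℝ), 0 < ℓ₀ ∧ 0 < c ∧ (∀ β, 0 < a β) ∧ Filter.Tendsto a Filter.atTop (nhds 0) ∧ (∀ s : ℝ, 0 < s → s ≤ ℓ₀ → 0 < Γ s ∧ Γ s ≤ 1) ∧ ∀ (L : ℕ) [NeZero L] (β : ℝ), β₀ ≤ β → (L : ℝ) * a β ≤ ℓ₀ → let P : (Fin 4 → ZMod L) → Fin 4 → Fin 4 → GaugeConfig 4 L G → ℝ := fun x i j U => (r.N : ℝ) - (r.ρ (plaquetteHolonomy U x i j)).trace.re; let E : (GaugeConfig 4 L G → ℝ) → ℝ := fun F => wilsonExpectation (d := 4) (L := L) r.ρ β F; let cov : (GaugeConfig 4 L G → ℝ) → (GaugeConfig 4 L G → ℝ) → ℝ := fun F F' => E (fun U => F U * F' U) - E F * E F'; let dist : (Fin 4 → ZMod L) → (Fin 4 → ZMod L) → ℝ := fun x y => Real.sqrt (∑ k : Fin 4, (((x k - y k).valMinAbs : ℤ) :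 ℝ) ^ 2); (∀ n : ℕ, 1 ≤ n → 8 * n ≤ L → c * Γ ((n : ℝ) * a β) ≤ (n : ℝ) ^ 8 * cov (P 0 0 1) (P (Pi.single (2 : Fin 4) ((n : ℕ) : ZMod L)) 0 1) ∧ (n : ℝ) ^ 8 * cov (P 0 0 1) (P (Pi.single (2 : Fin 4) ((n : ℕ) : ZMod L)) 0 1) ≤ C * Γ ((n : ℝ) * a β)) ∧ (∀ (x y : Fin 4 → ZMod L) (i j i' j' : Fin 4), x ≠ y → i ≠ j → i' ≠ j' → |cov (P x i j) (P y i' j')| * dist x y ^ 8 ≤ C * Γ (dist x y * a β))) ∧ (∃ (Γ₃ : ℝ → ℝ) (β₁ ℓ₁ c₃ : ℝ), 0 < ℓ₁ ∧ 0 < c₃ ∧ (∀ s : ℝ, 0 < s → s ≤ ℓ₁ → 0 < Γ₃ s) ∧ ∀ (L : ℕ) [NeZero L] (β : ℝ), β₁ ≤ β → (L : ℝ) * a β ≤ ℓ₁ → let P : (Fin 4 → ZMod L) → Fin 4 → Fin 4 → GaugeConfig 4 L G → ℝ := fun x i j U => (r.N : ℝ) - (r.ρ (plaquetteHolonomy U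 x i j)).trace.re; let E : (GaugeConfig 4 L G → ℝ) → ℝ := fun F => wilsonExpectation (d := 4) (L := L) r.ρ β F; let cov : (GaugeConfig 4 L G → ℝ) → (GaugeConfig 4 L G → ℝ) → ℝ := fun F F' => E (fun U => F U * F' U) - E F * E F'; ∀ n : ℕ, 1 ≤ n → 8 * n ≤ L → c₃ * Γ₃ ((n : ℝ) * a β) ≤ (n : ℝ) ^ 12 * |E (fun U => P 0 0 1 U * P (Pi.single (2 : Fin 4) ((n : ℕ) : ZMod L)) 0 1 U * P (Pi.single (3 : Fin 4) ((n : ℕ) : ZMod L)) 0 1 U) - E (P 0 0 1) * cov (P (Pi.single (2 : Fin 4) ((n : ℕ) : ZMod L)) 0 1) (P (Pi.single (3 : Fin 4) ((n : ℕ) : ZMod L)) 0 1) - E (P (Pi.single (2 : Fin 4) ((n : ℕ) : ZMod L)) 0 1) * cov (P 0 0 1) (P (Pi.single (3 : Fin 4) ((n : ℕ) : ZMod L)) 0 1) - E (P (Pi.single (3 : Fin 4) ((n : ℕ) : ZMod L)) 0 1) * cov (P 0 0 1) (P (Pi.single (2 : Fin 4) ((n : ℕ) : ZMod L)) 0 1)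 - E (P 0 0 1) * E (P (Pi.single (2 : Fin 4) ((n : ℕ) : ZMod L)) 0 1) * E (P (Pi.single (3 : Fin 4) ((n : ℕ) : ZMod L)) 0 1)|)

/-- **EngineMapIsFastest — the residual of the TYPED (∀ a) crux.** Some map carrying the package
and the rigidity bound is, up to a constant, a lower bound for EVERY map carrying the package
(no unit map decaying faster than the physical scale admits cutoff-uniform two-sided bounds). This is
the infrared-flavoured statement the ∀ a form silently contains (NOTES F6: step-dip maps); with it,
`crux_of_core` gives the crux as typed. -/
def EngineMapIsFastest : Prop :=
  open Literature.MathematicalPhysics.QuantumFieldTheory in ∀ (G : Type) [Group G] [TopologicalSpace G] [IsTopologicalGroup G] [CompactSpace G], IsCompactSimpleLieGroup G → letI : MeasurableSpace G := borel G; haveI : BorelSpace G := ⟨rfl⟩; ∀ (r : LatticeRep G), ∃ (a : ℝ → ℝ), (∃ (Γ : ℝ → ℝ) (β₀ ℓ₀ c C : ℝ), 0 < ℓ₀ ∧ 0 < c ∧ (∀ β, 0 < a β) ∧ Filter.Tendsto a Filter.atTop (nhds 0) ∧ (∀ s : ℝ, 0 < s → s ≤ ℓ₀ → 0 < Γ s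 ∧ Γ s ≤ 1) ∧ ∀ (L : ℕ) [NeZero L] (β : ℝ), β₀ ≤ β → (L : ℝ) * a β ≤ ℓ₀ → let P : (Fin 4 → ZMod L) → Fin 4 → Fin 4 → GaugeConfig 4 L G → ℝ := fun x i j U => (r.N : ℝ) - (r.ρ (plaquetteHolonomy U x i j)).trace.re; let E : (GaugeConfig 4 L G → ℝ) → ℝ := fun F => wilsonExpectation (d := 4) (L := L) r.ρ β F; let cov : (GaugeConfig 4 L G → ℝ) → (GaugeConfig 4 L G → ℝ) → ℝ := fun F F' => E (fun U => F U * F' U) - E F * E F'; let dist : (Fin 4 → ZMod L) → (Fin 4 → ZMod L) → ℝ := fun x y => Real.sqrt (∑ k : Fin 4, (((x k - y k).valMinAbs : ℤ) : ℝ) ^ 2); (∀ n : ℕ, 1 ≤ n → 8 * n ≤ L → c * Γ ((n : ℝ) * a β) ≤ (n : ℝ) ^ 8 * cov (P 0 0 1) (P (Pi.single (2 : Fin 4) ((n : ℕ) : ZMod L)) 0 1) ∧ (n : ℝ) ^ 8 * cov (P 0 0 1) (P (Pi.single (2 : Fin 4) ((n : ℕ) : ZMod L)) 0 1) ≤ C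 * Γ ((n : ℝ) * a β)) ∧ (∀ (x y : Fin 4 → ZMod L) (i j i' j' : Fin 4), x ≠ y → i ≠ j → i' ≠ j' → |cov (P x i j) (P y i' j')| * dist x y ^ 8 ≤ C * Γ (dist x y * a β))) ∧ (∃ (β₁ ℓ₁ c₃ : ℝ), 0 < ℓ₁ ∧ 0 < c₃ ∧ ∀ (L : ℕ) [NeZero L] (β : ℝ), β₁ ≤ β → (L : ℝ) * a β ≤ ℓ₁ → let P : (Fin 4 → ZMod L) → Fin 4 → Fin 4 → GaugeConfig 4 L G → ℝ := fun x i j U => (r.N : ℝ) - (r.ρ (plaquetteHolonomy U x i j)).trace.re; let E : (GaugeConfig 4 L G → ℝ) → ℝ := fun F => wilsonExpectation (d := 4) (L := L) r.ρ β F; let cov : (GaugeConfig 4 L G → ℝ) → (GaugeConfig 4 L G → ℝ) → ℝ := fun F F' => E (fun U => F U * F' U) - E F * E F'; ∀ n : ℕ, 1 ≤ n → 8 * n ≤ L → c₃ * ((n : ℝ) ^ 8 * cov (P 0 0 1) (P (Pi.single (2 : Fin 4) ((n : ℕ) : ZMod L)) 0 1)) * Real.sqrt ((n : ℝ) ^ 8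 * cov (P 0 0 1) (P (Pi.single (2 : Fin 4) ((n : ℕ) : ZMod L)) 0 1)) ≤ (n : ℝ) ^ 12 * |E (fun U => P 0 0 1 U * P (Pi.single (2 : Fin 4) ((n : ℕ) : ZMod L)) 0 1 U * P (Pi.single (3 : Fin 4) ((n : ℕ) : ZMod L)) 0 1 U) - E (P 0 0 1) * cov (P (Pi.single (2 : Fin 4) ((n : ℕ) : ZMod L)) 0 1) (P (Pi.single (3 : Fin 4) ((n : ℕ) : ZMod L)) 0 1) - E (P (Pi.single (2 : Fin 4) ((n : ℕ) : ZMod L)) 0 1) * cov (P 0 0 1) (P (Pi.single (3 : Fin 4) ((n : ℕ) : ZMod L)) 0 1) - E (P (Pi.single (3 : Fin 4) ((n : ℕ) : ZMod L)) 0 1) * cov (P 0 0 1) (P (Pi.single (2 : Fin 4) ((n : ℕ) : ZMod L)) 0 1) - E (P 0 0 1) * E (P (Pi.single (2 : Fin 4) ((n : ℕ) : ZMod L)) 0 1) * E (P (Pi.single (3 : Fin 4) ((n : ℕ) : ZMod L)) 0 1)|) ∧ ∀ (a' : ℝ → ℝ), (∃ (Γ : ℝ → ℝ) (β₀ ℓ₀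 c C : ℝ), 0 < ℓ₀ ∧ 0 < c ∧ (∀ β, 0 < a' β) ∧ Filter.Tendsto a' Filter.atTop (nhds 0) ∧ (∀ s : ℝ, 0 < s → s ≤ ℓ₀ → 0 < Γ s ∧ Γ s ≤ 1) ∧ ∀ (L : ℕ) [NeZero L] (β : ℝ), β₀ ≤ β → (L : ℝ) * a' β ≤ ℓ₀ → let P : (Fin 4 → ZMod L) → Fin 4 → Fin 4 → GaugeConfig 4 L G → ℝ := fun x i j U => (r.N : ℝ) - (r.ρ (plaquetteHolonomy U x i j)).trace.re; let E : (GaugeConfig 4 L G → ℝ) → ℝ := fun F => wilsonExpectation (d := 4) (L := L) r.ρ β F; let cov : (GaugeConfig 4 L G → ℝ) → (GaugeConfig 4 L G → ℝ) → ℝ := fun F F' => E (fun U => F U * F' U) - E F * E F'; let dist : (Fin 4 → ZMod L) → (Fin 4 → ZMod L) → ℝ := fun x y => Real.sqrt (∑ k : Fin 4, (((x k - y k).valMinAbs : ℤ) : ℝ) ^ 2); (∀ n : ℕ, 1 ≤ n → 8 * n ≤ L → c * Γ ((n : ℝ) * a' β) ≤ (n : ℝ) ^ 8 * cov (P 0 0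 1) (P (Pi.single (2 : Fin 4) ((n : ℕ) : ZMod L)) 0 1) ∧ (n : ℝ) ^ 8 * cov (P 0 0 1) (P (Pi.single (2 : Fin 4) ((n : ℕ) : ZMod L)) 0 1) ≤ C * Γ ((n : ℝ) * a' β)) ∧ (∀ (x y : Fin 4 → ZMod L) (i j i' j' : Fin 4), x ≠ y → i ≠ j → i' ≠ j' → |cov (P x i j) (P y i' j')| * dist x y ^ 8 ≤ C * Γ (dist x y * a' β))) → ∃ (ε β₂ : ℝ), 0 < ε ∧ ∀ β : ℝ, β₂ ≤ β → ε * a β ≤ a' β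

/-- the ∃-bundled form is weaker than the pair of route items (pure logic). -/
theorem forPackageMap_of_crux :
    Summit.QuantumFields.YangMills.Theses.LangevinControlUV.FemtoCurvatureTwoPoint →
    Summit.QuantumFields.YangMills.Theses.LangevinControlUV.FemtoCurvatureSkewness →
    SkewnessForPackageMap := by
  intro h2 h3 G _ _ _ _ hG r _
  obtain ⟨a, ha⟩ := h2 G hG r
  exact ⟨a, ha, h3 G hG r a ha⟩

/-- card transfer: the core gives the assembly-sufficient form (Γ₃ := (c·Γ)^{3/2}; elementary). -/
theorem forPackageMap_of_core : RigidityCore → SkewnessForPackageMap := by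
  intro h G _ _ _ _ hG r _
  obtain ⟨a, hPa, β₁, ℓ₁, c₃, hℓ₁, hc₃, hLB⟩ := h G hG r
  obtain ⟨Γ, β₀, ℓ₀, c, C, hℓ₀, hc, hapos, hatend, hΓ, hpack⟩ := hPa
  refine ⟨a, ⟨Γ, β₀, ℓ₀, c, C, hℓ₀, hc, hapos, hatend, hΓ, hpack⟩,
    fun s => (c * Γ s) * Real.sqrt (c * Γ s), max β₁ β₀, min ℓ₁ ℓ₀, c₃, lt_min hℓ₁ hℓ₀, hc₃, ?_, ?_⟩
  · intro s hs hsl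
    have : 0 < c * Γ s := mul_pos hc (hΓ s hs (hsl.trans (min_le_right _ _))).1
    positivity
  · intro L _ β hβ hL
    have hβ₁ : β₁ ≤ β := le_trans (le_max_left _ _) hβ
    have hβ₀ : β₀ ≤ β := le_trans (le_max_right _ _) hβ
    have hcore := hLB L β hβ₁ (hL.trans (min_le_left _ _))
    have hpk := hpack L β hβ₀ (hL.trans (min_le_right _ _))
    intro P E cov n hn h8
    have hc1 := hcore n hn h8
    have hlow : c * Γ ((n : ℝ) * a β) ≤ (n : ℝ) ^ 8 * cov (P 0 0 1) (P (Pi.single (2 : Fin 4) ((n : ℕ) : ZMod L)) 0 1) :=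
      ((hpk.1) n hn h8).1
    have hpos : 0 ≤ c * Γ ((n : ℝ) * a β) := by
      have hs : 0 < (n : ℝ) * a β := mul_pos (by exact_mod_cast hn) (hapos β)
      have hsl : (n : ℝ) * a β ≤ ℓ₀ := by
        have : (n : ℝ) * a β ≤ (L : ℝ) * a β := by
          have : (n : ℝ) ≤ (L : ℝ) := by exact_mod_cast (le_trans (Nat.le_mul_of_pos_left n (by norm_num)) h8)
          exact mul_le_mul_of_nonneg_right this (hapos β).le
        exact this.trans (hL.trans (min_le_right _ _))
      exact (mul_pos hc (hΓ _ hs hsl).1).le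
    have hmono : c * Γ ((n : ℝ) * a β) * Real.sqrt (c * Γ ((n : ℝ) * a β)) ≤
        (n : ℝ) ^ 8 * cov (P 0 0 1) (P (Pi.single (2 : Fin 4) ((n : ℕ) : ZMod L)) 0 1) *
          Real.sqrt ((n : ℝ) ^ 8 * cov (P 0 0 1) (P (Pi.single (2 : Fin 4) ((n : ℕ) : ZMod L)) 0 1)) :=
      mul_le_mul hlow (Real.sqrt_le_sqrt hlow) (Real.sqrt_nonneg _) (hpos.trans hlow)
    calc c₃ * (c * Γ ((n : ℝ) * a β) * Real.sqrt (c * Γ ((n : ℝ) * a β)))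
        ≤ c₃ * ((n : ℝ) ^ 8 * cov (P 0 0 1) (P (Pi.single (2 : Fin 4) ((n : ℕ) : ZMod L)) 0 1) *
          Real.sqrt ((n : ℝ) ^ 8 * cov (P 0 0 1) (P (Pi.single (2 : Fin 4) ((n : ℕ) : ZMod L)) 0 1))) :=
          mul_le_mul_of_nonneg_left hmono hc₃.le
      _ ≤ _ := by simpa [mul_assoc] using hc1

/-- card transfer: dominance ⇒ core (`lower_of_relative_error` + monotonicity of `√`; elementary). -/
theorem core_of_dominance : PermanentalDominance → RigidityCore := by
  intro h G _ _ _ _ hG r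
  obtain ⟨a, hPa, β₁, ℓ₁, d, θ, c', hℓ₁, hd, hθ0, hθ1, hc', H⟩ := h G hG r
  have hsd : 0 < Real.sqrt 8 / Real.sqrt d := div_pos (Real.sqrt_pos.2 (by norm_num)) (Real.sqrt_pos.2 hd)
  refine ⟨a, hPa, β₁, ℓ₁, (1 - θ) * (Real.sqrt 8 / Real.sqrt d) * c', hℓ₁, ?_, ?_⟩
  · have : 0 < 1 - θ := by linarith
    positivity
  · intro L _ β hβ hL
    have HL := H L β hβ hL
    intro P E cov n hn h8
    obtain ⟨hdom, hB, hC⟩ := HL n hn h8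
    -- abbreviations
    set A := (n : ℝ) ^ 8 * cov (P 0 0 1) (P (Pi.single (2 : Fin 4) ((n : ℕ) : ZMod L)) 0 1) with hAdef
    set B := (n : ℝ) ^ 8 * cov (P 0 0 1) (P (Pi.single (3 : Fin 4) ((n : ℕ) : ZMod L)) 0 1) with hBdef
    set C := (n : ℝ) ^ 8 * cov (P (Pi.single (2 : Fin 4) ((n : ℕ) : ZMod L)) 0 1)
      (P (Pi.single (3 : Fin 4) ((n : ℕ) : ZMod L)) 0 1) with hCdef
    set K := (n : ℝ) ^ 12 * |E (fun U => P 0 0 1 U * P (Pi.single (2 : Fin 4) ((n : ℕ) : ZMod L)) 0 1 U *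
        P (Pi.single (3 : Fin 4) ((n : ℕ) : ZMod L)) 0 1 U) -
      E (P 0 0 1) * cov (P (Pi.single (2 : Fin 4) ((n : ℕ) : ZMod L)) 0 1) (P (Pi.single (3 : Fin 4) ((n : ℕ) : ZMod L)) 0 1) -
      E (P (Pi.single (2 : Fin 4) ((n : ℕ) : ZMod L)) 0 1) * cov (P 0 0 1) (P (Pi.single (3 : Fin 4) ((n : ℕ) : ZMod L)) 0 1) -
      E (P (Pi.single (3 : Fin 4) ((n : ℕ) : ZMod L)) 0 1) * cov (P 0 0 1) (P (Pi.single (2 : Fin 4) ((n : ℕ) : ZMod L)) 0 1) -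
      E (P 0 0 1) * E (P (Pi.single (2 : Fin 4) ((n : ℕ) : ZMod L)) 0 1) * E (P (Pi.single (3 : Fin 4) ((n : ℕ) : ZMod L)) 0 1)|
      with hKdef
    have hK0 : 0 ≤ K := by positivity
    have hlow := lower_of_relative_error K _ θ hdom
    -- (1-θ) * pred ≤ K, pred = (√8/√d) * √(A*B*C)
    by_cases hA : 0 ≤ A
    · have hcA : 0 ≤ c' * A := by positivity
      have hBC : c' * A * (c' * A) ≤ B * C := mul_le_mul hB hC hcA (hcA.trans hB)
      have hsq : c' * A * Real.sqrt A ≤ Real.sqrt (A * B * C) := by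
        rw [Real.le_sqrt (mul_nonneg hcA (Real.sqrt_nonneg A)) (mul_nonneg (mul_nonneg hA (hcA.trans hB)) (hcA.trans hC))]
        have h1 : (c' * A * Real.sqrt A) ^ 2 = c' * A * (c' * A) * A := by
          rw [mul_pow, Real.sq_sqrt hA]; ring
        rw [h1]
        nlinarith [mul_le_mul_of_nonneg_right hBC hA]
      have h1θ : 0 ≤ 1 - θ := by linarith
      calc (1 - θ) * (Real.sqrt 8 / Real.sqrt d) * c' * A * Real.sqrt A
          = (1 - θ) * ((Real.sqrt 8 / Real.sqrt d) * (c' * A * Real.sqrt A)) := by ring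
        _ ≤ (1 - θ) * ((Real.sqrt 8 / Real.sqrt d) * Real.sqrt (A * B * C)) :=
            mul_le_mul_of_nonneg_left (mul_le_mul_of_nonneg_left hsq hsd.le) h1θ
        _ ≤ K := hlow
    · rw [not_le] at hA
      have : Real.sqrt A = 0 := Real.sqrt_eq_zero'.2 hA.le
      rw [this, mul_zero]
      exact hK0

/-- the crux AS TYPED = core + the residual `EngineMapIsFastest` (elementary: for `β ≥ β₂` the regime
`L·a' ≤ ε ℓ₁` lies inside `L·a ≤ ℓ₁`, and the bound `c₃ (n⁸Cov)^{3/2} ≥ c₃ (c Γ'(n a' β))^{3/2}` uses the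
package of `a'` itself). -/
theorem crux_of_core : EngineMapIsFastest →
    Summit.QuantumFields.YangMills.Theses.LangevinControlUV.FemtoCurvatureSkewness := by
  intro h G _ _ _ _ hG r a' ha'
  obtain ⟨a, hPa, ⟨β₁, ℓ₁, c₃, hℓ₁, hc₃, hLB⟩, hfast⟩ := h G hG r
  obtain ⟨ε, β₂, hε, hcmp⟩ := hfast a' ha'
  obtain ⟨Γ', β₀', ℓ₀', c', C', hℓ₀', hc', ha'pos, ha'tend, hΓ', hpack'⟩ := ha'
  refine ⟨fun s => (c' * Γ' s) * Real.sqrt (c' * Γ' s), max (max β₁ β₂) β₀', min (ε * ℓ₁) ℓ₀', c₃,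
    lt_min (mul_pos hε hℓ₁) hℓ₀', hc₃, ?_, ?_⟩
  · intro s hs hsl
    have hG' := (hΓ' s hs (hsl.trans (min_le_right _ _))).1
    have : 0 < c' * Γ' s := mul_pos hc' hG'
    positivity
  · intro L _ β hβ hL
    have hβ₁ : β₁ ≤ β := le_trans (le_trans (le_max_left _ _) (le_max_left _ _)) hβ
    have hβ₂ : β₂ ≤ β := le_trans (le_trans (le_max_right _ _) (le_max_left _ _)) hβ
    have hβ₀' : β₀' ≤ β := le_trans (le_max_right _ _) hβ
    have hLa' : (L : ℝ) * a' β ≤ ℓ₀' := hL.trans (min_le_right _ _)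
    have hLa : (L : ℝ) * a β ≤ ℓ₁ := by
      have h1 : ε * a β ≤ a' β := hcmp β hβ₂
      have h2 : (L : ℝ) * a' β ≤ ε * ℓ₁ := hL.trans (min_le_left _ _)
      have hL0 : (0 : ℝ) ≤ L := Nat.cast_nonneg L
      have h3 : ε * ((L : ℝ) * a β) ≤ ε * ℓ₁ := by nlinarith [mul_le_mul_of_nonneg_left h1 hL0]
      exact le_of_mul_le_mul_left h3 hε
    have hcore := hLB L β hβ₁ hLa
    have hpk := hpack' L β hβ₀' hLa'
    intro P E cov n hn h8
    have hc1 := hcore n hn h8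
    have hp1 := ((hpk.1) n hn h8).1
    -- monotonicity of t ↦ t √t
    have hlow : c' * Γ' ((n : ℝ) * a' β) ≤ (n : ℝ) ^ 8 * cov (P 0 0 1) (P (Pi.single (2 : Fin 4) ((n : ℕ) : ZMod L)) 0 1) := hp1
    have hpos : 0 ≤ c' * Γ' ((n : ℝ) * a' β) := by
      have hs : 0 < (n : ℝ) * a' β := mul_pos (by exact_mod_cast hn) (ha'pos β)
      have hsl : (n : ℝ) * a' β ≤ ℓ₀' := by
        have : (n : ℝ) * a' β ≤ (L : ℝ) * a' β := by
          have : (n : ℝ) ≤ (L : ℝ) := by exact_mod_cast (le_trans (Nat.le_mul_of_pos_left n (by norm_num)) h8)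
          exact mul_le_mul_of_nonneg_right this (ha'pos β).le
        exact this.trans hLa'
      exact (mul_pos hc' (hΓ' _ hs hsl).1).le
    have hmono : c' * Γ' ((n : ℝ) * a' β) * Real.sqrt (c' * Γ' ((n : ℝ) * a' β)) ≤
        (n : ℝ) ^ 8 * cov (P 0 0 1) (P (Pi.single (2 : Fin 4) ((n : ℕ) : ZMod L)) 0 1) *
          Real.sqrt ((n : ℝ) ^ 8 * cov (P 0 0 1) (P (Pi.single (2 : Fin 4) ((n : ℕ) : ZMod L)) 0 1)) :=
      mul_le_mul hlow (Real.sqrt_le_sqrt hlow) (Real.sqrt_nonneg _) (hpos.trans hlow)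
    calc c₃ * (c' * Γ' ((n : ℝ) * a' β) * Real.sqrt (c' * Γ' ((n : ℝ) * a' β)))
        ≤ c₃ * ((n : ℝ) ^ 8 * cov (P 0 0 1) (P (Pi.single (2 : Fin 4) ((n : ℕ) : ZMod L)) 0 1) *
          Real.sqrt ((n : ℝ) ^ 8 * cov (P 0 0 1) (P (Pi.single (2 : Fin 4) ((n : ℕ) : ZMod L)) 0 1))) :=
          mul_le_mul_of_nonneg_left hmono hc₃.le
      _ ≤ _ := by simpa [mul_assoc] using hc1

end

end Summit.QuantumFields.YangMills.Cruxes.FemtoCurvatureSkewness.Sketch
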